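import Mathlib.Geometry.Manifold.Metrizable
import Literature.Geometry.Lorentzian.SubdevelopmentCausalConvexity
import Literature.Geometry.Lorentzian.SpacelikeBoundaryFuturePoint
import Literature.Geometry.Lorentzian.CausalityClosure
import Literature.Geometry.Lorentzian.CorrespondingBoundaryTimelike
import HarnessLib

/-!
# Corresponding boundary points over a sub-datum, I: the past shadow of the image point is a
# relatively compact part of the sub-datum

Setting (pure causality; the instance is a relative common development `(U ⊆ M₁, ψ : U → M₂)`
of a development `M₁` of data on `N` and a development `M₂` of data on `X ⊇ Φ(N)`,
Hawking–Ellis 1973, §7.6; Sbierski 2016, §3.2 for `N = X`). Two time-oriented Lorentzian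
manifolds `M₁`, `M₂` with Cauchy hypersurfaces `S₁`, `S₂`; an open `U ⊆ M₁` containing `S₁` in
which `S₁` is a Cauchy hypersurface; an open `W ⊆ M₂` in which `S₂ ∩ W` is a Cauchy hypersurface,
with `W ∩ S₂ ⊆ S₀ ⊆ S₂` (`S₀` = the sub-datum `ι₂(Φ N)`); a map `ψ : M₁ → M₂`, continuous on `U`,
with `ψ(U) ⊆ W`, `ψ(S₁) = S₀`, carrying timelike segments inside `U` forward and timelike
segments inside `W` between image points backward (`hpush`, `hpull`). A boundary point
`p ∈ ∂U ∩ I⁺(S₁)` and a point `p' ∈ M₂` *correspond* (Sbierski 2016, Def. 11) if every pair of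
neighbourhoods `V ∋ p`, `V' ∋ p'` contains `y ∈ U ∩ V` with `ψ y ∈ V'`.

Results (the global-hyperbolicity consequences used — compactness of `J⁻(x) ∩ J⁺(S₁)` in `M₁`,
Hawking–Ellis 1973, Prop. 6.6.6, and sequential closedness of `≤` in `M₂`, O'Neill 1983,
Lemma 14.22 — are DISPLAYED hypotheses `hK₁`, `hrel₂`, exactly as in
`SpacelikeBoundaryFuturePoint`):

* `exists_mem_opens_ll_ll` — points `r ≪ r₁ ≪ p` of `U ∩ I⁺(S₁)` just below `p`;
* `glue_mem_chronologicalFuture_of_mem` — `ψ` preserves `≪` between points of `U`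
  (the segment stays in `U` by causal convexity, `SubdevelopmentCausalConvexity`);
* `mem_causalFuture_glue_of_corresponding`, `mem_chronologicalFuture_glue_of_corresponding` —
  **`ψ r₁ ≤ p'` and `ψ r ≪ p'`** (relative form of the first half of Sbierski's Prop. 13:
  `ψ(I⁻(p) ∩ U) ⊆ I⁻(p')`); hence `p' ∈ I⁺(S₂)`, `p' ∉ S₂`;
* `not_mem_closure_chronologicalPast_of_corresponding` — **`p' ∉ closure (I⁻(S₂))`**;
* `chronologicalPast_inter_subset_image_of_corresponding` — **the shadow bound**: for `p ≪ p⁺`,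
  `I⁻(p') ∩ S₂ ⊆ ψ(J⁻(p⁺) ∩ S₁)`, a compact subset of `S₀`
  (`isCompact_image_causalPast_inter`): the half of Prop. 13 `I⁻(p') ∩ ψ(U) ⊆ ψ(I⁻(p) ∩ U)` read
  on the data hypersurfaces, combined with the compactness of `J⁻(p⁺) ∩ S₁`.

The sequel (`CorrespondingBoundaryDomain`) concludes that `p'` lies outside
`closure (I⁺(S₂ ∖ S₀) ∪ I⁻(S₂ ∖ S₀) ∪ (S₂ ∖ S₀))`, i.e. inside the Cauchy piece domain of the
sub-datum `S₀` (`CauchyPieceDomain`). Everything is proved; no definitions, no named facts.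

## References

* J. Sbierski, Ann. Henri Poincaré 17 (2016) 301–329 = arXiv:1309.7591v3, §3.2, Def. 11,
  Prop. 13 and its proof (arXiv numbering). [Sbierski2016AHP]
* S. W. Hawking, G. F. R. Ellis, *The large scale structure of space-time*, CUP 1973, §6.5,
  Prop. 6.6.6, §7.6 pp. 249–251. [HawkingEllis1973CUP]
* B. O'Neill, *Semi-Riemannian geometry with applications to relativity*, Academic Press 1983,
  Ch. 14, Cor. 14.1, Lemma 14.3, Lemma 14.22, Lemma 14.29. [ONeillSemiRiemannian1983]
-/

noncomputable section

open Set Filter Function TopologicalSpace Topology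
open scoped Manifold ContDiff Topology

namespace Literature.Geometry.Lorentzian

namespace LorentzianMetric

variable {E : Type*} [NormedAddCommGroup E] [NormedSpace ℝ E] {H : Type*} [TopologicalSpace H]
  {I : ModelWithCorners ℝ E H} {n : ℕ∞ω} {M : Type*} [TopologicalSpace M] [ChartedSpace H M]
  [IsManifold I ∞ M] {g : LorentzianMetric I n M} {τ : TimeOrientation g}

/-! ### Elementary causal bookkeeping -/

/-- Along a future causal curve on `[a, b]`, later points are in the causal future of earlier
ones: `γ s ≤ γ t` for `a ≤ s ≤ t ≤ b`. O'Neill 1983, Ch. 14, p. 402. [cite: ONeillSemiRiemannian1983, Ch. 14, p. 402] -/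
theorem mem_causalFuture_of_curve {γ : ℝ → M} {a b : ℝ} (hγ : g.IsFutureCausalCurveOn τ γ (Icc a b))
    {s t : ℝ} (hs : a ≤ s) (hst : s ≤ t) (ht : t ≤ b) : γ t ∈ g.causalFuture τ {γ s} := by
  rcases eq_or_lt_of_le hst with h | h
  · rw [h]
    exact subset_causalFuture g τ _ rfl
  · exact Or.inr ⟨γ s, rfl, γ, s, t, h, hγ.mono (Icc_subset_Icc hs ht), rfl, rfl⟩

/-- Along a future timelike curve on `[a, b]`, later points are in the chronological future of
earlier ones: `γ s ≪ γ t` for `a ≤ s < t ≤ b`. O'Neill 1983, Ch. 14, p. 402. [cite: ONeillSemiRiemannian1983, Ch. 14, p. 402] -/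
theorem mem_chronologicalFuture_of_curve {γ : ℝ → M} {a b : ℝ}
    (hγ : g.IsFutureTimelikeCurveOn τ γ (Icc a b)) {s t : ℝ} (hs : a ≤ s) (hst : s < t)
    (ht : t ≤ b) : γ t ∈ g.chronologicalFuture τ {γ s} :=
  ⟨γ s, rfl, γ, s, t, hst, hγ.mono (Icc_subset_Icc hs ht), rfl, rfl⟩

/-- **Above every point there is a chronologically later one** (`I⁺(x) ≠ ∅`: a point on the
endless timelike curve through `x`, `exists_isEndlessTimelikeCurve_through`). O'Neill 1983,
Ch. 14, p. 402 and Prop. 31. [cite: ONeillSemiRiemannian1983, Ch. 14, Lemma 29 and Prop. 31 (pp. 415–417)] -/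
theorem exists_mem_chronologicalFuture_singleton [T2Space M] [SecondCountableTopology M]
    [BoundarylessManifold I M] [FiniteDimensional ℝ E] (hn : 2 ≤ n) (x : M) :
    ∃ y, y ∈ g.chronologicalFuture τ {x} := by
  obtain ⟨γ, D, hγD, h0D, hγ0⟩ := exists_isEndlessTimelikeCurve_through (g := g) (τ := τ) hn x
  obtain ⟨ε, hε, hεD⟩ : ∃ ε > 0, ε ∈ D := by
    by_contra hcon
    push Not at hcon
    have hDle : ∀ t ∈ D, t ≤ 0 := fun t ht ↦ not_lt.1 fun h ↦ hcon t h ht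
    refine hγD.2.2.1.2 (γ 0) ?_
    exact tendsto_atTop_of_eventually_const (i₀ := (⟨0, h0D⟩ : D)) fun i hi ↦
      congrArg γ (le_antisymm (hDle i i.2) hi)
  refine ⟨γ ε, x, rfl, γ, 0, ε, hε, hγD.2.1.mono (hγD.1.out h0D hεD), hγ0, rfl⟩

/-- **Below every point there is a chronologically earlier one** (time dual). [cite: ONeillSemiRiemannian1983, Ch. 14, Lemma 29 and Prop. 31 (pp. 415–417)] -/
theorem exists_mem_chronologicalPast_singleton [T2Space M] [SecondCountableTopology M]
    [BoundarylessManifold I M] [FiniteDimensional ℝ E] (hn : 2 ≤ n) (x : M) :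
    ∃ y, y ∈ g.chronologicalPast τ {x} :=
  exists_mem_chronologicalFuture_singleton (τ := τ.reverse) hn x

/-- **Sequential closedness of `≤` gives `closure (I⁺(x)) ⊆ J⁺(x)`** (on a metrizable spacetime).
O'Neill 1983, Ch. 14, Lemma 14.22 and Lemma 14.6. [cite: ONeillSemiRiemannian1983, Ch. 14, Lemma 14.22 (p. 412)] -/
theorem mem_causalFuture_of_mem_closure_chronologicalFuture [FrechetUrysohnSpace M]
    (hrel : ∀ {xs ys : ℕ → M} {x y : M}, Tendsto xs atTop (𝓝 x) → Tendsto ys atTop (𝓝 y) →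
      (∀ j, ys j ∈ g.causalFuture τ {xs j}) → y ∈ g.causalFuture τ {x})
    {x y : M} (h : y ∈ closure (g.chronologicalFuture τ {x})) : y ∈ g.causalFuture τ {x} := by
  obtain ⟨u, hu, hlim⟩ := mem_closure_iff_seq_limit.1 h
  exact hrel tendsto_const_nhds hlim fun j ↦ chronologicalFuture_subset_causalFuture g τ {x} (hu j)

/-! ### The setting: standing hypotheses as explicit arguments -/

section Core

variable {E₁ : Type*} [NormedAddCommGroup E₁] [NormedSpace ℝ E₁] {H₁ : Type*} [TopologicalSpace H₁]
  {I₁ : ModelWithCorners ℝ E₁ H₁} {n₁ : ℕ∞ω} {M₁ : Type*} [TopologicalSpace M₁] [ChartedSpace H₁ M₁]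
  [IsManifold I₁ ∞ M₁] [T2Space M₁] [SecondCountableTopology M₁] [BoundarylessManifold I₁ M₁]
  [FiniteDimensional ℝ E₁] {g₁ : LorentzianMetric I₁ n₁ M₁} {τ₁ : TimeOrientation g₁}
  {E₂ : Type*} [NormedAddCommGroup E₂] [NormedSpace ℝ E₂] {H₂ : Type*} [TopologicalSpace H₂]
  {I₂ : ModelWithCorners ℝ E₂ H₂} {n₂ : ℕ∞ω} {M₂ : Type*} [TopologicalSpace M₂] [ChartedSpace H₂ M₂]
  [IsManifold I₂ ∞ M₂] [T2Space M₂] [SecondCountableTopology M₂] [BoundarylessManifold I₂ M₂]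
  [FiniteDimensional ℝ E₂] {g₂ : LorentzianMetric I₂ n₂ M₂} {τ₂ : TimeOrientation g₂}

/-- **Points of `U ∩ I⁺(S₁)` just below a future boundary point.** If `S₁` is a Cauchy
hypersurface of `M₁` and of the open sub-spacetime `U`, and `p ∈ ∂U ∩ I⁺(S₁)`, there are
`r ≪ r₁ ≪ p` in `U ∩ I⁺(S₁)`: points of the timelike curve through `p` slightly before `p` lie in
the open set `I⁺(S₁)`, and in `U` by "no timelike entry"
(`IsAchronal.mem_opens_of_mem_closure_of_mem_chronologicalFuture`). Sbierski 2016, §3.2, proof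
of Prop. 13 ("take an `s ∈ U` with `q ≪ s ≪ p`"). [cite: Sbierski2016AHP, §3.2, proof of Prop. 13 (arXiv numbering)] -/
theorem exists_mem_opens_ll_ll (hn₁ : 2 ≤ n₁)
    (hres₁ : PseudoRiemannianMetric.contMDiff_restrict (I := I₁) (n := n₁) (M := M₁))
    (hτ₁ : τ₁.contMDiff_restrict) {S₁ : Set M₁} (hS₁ : g₁.IsCauchyHypersurface τ₁ S₁)
    {U : Opens M₁}
    (hU : (g₁.restrict hres₁ U).IsCauchyHypersurface (τ₁.restrict hres₁ hτ₁ U) (Subtype.val ⁻¹' S₁))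
    {p : M₁} (hp : p ∈ frontier (U : Set M₁)) (hpI : p ∈ g₁.chronologicalFuture τ₁ S₁) :
    ∃ r r₁ : M₁, r ∈ U ∧ r₁ ∈ U ∧ r ∈ g₁.chronologicalFuture τ₁ S₁ ∧
      r₁ ∈ g₁.chronologicalFuture τ₁ {r} ∧ p ∈ g₁.chronologicalFuture τ₁ {r₁} := by
  have hA : g₁.IsAchronal τ₁ S₁ := IsCauchyHypersurface.isAchronal_holds hn₁ hS₁
  obtain ⟨Δ, D, hΔ, h0D, hΔ0⟩ := exists_isEndlessTimelikeCurve_through (g := g₁) (τ := τ₁) hn₁ p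
  -- a parameter `t₀ < 0` in `D`
  obtain ⟨t₀, ht₀D, ht₀⟩ : ∃ t₀ ∈ D, t₀ < 0 := by
    by_contra hcon
    push Not at hcon
    refine hΔ.2.2.2.2 (Δ 0) ?_
    exact tendsto_atBot_of_eventually_const (i₀ := (⟨0, h0D⟩ : D)) fun i hi ↦
      congrArg Δ (le_antisymm hi (hcon i i.2))
  -- near `0` the curve lies in the open set `I⁺(S₁)`
  have hcont0 : ContinuousAt Δ 0 := (hΔ.2.1 0 h0D).1.continuousAt
  have hnhds : Δ ⁻¹' g₁.chronologicalFuture τ₁ S₁ ∈ 𝓝 (0 : ℝ) :=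
    hcont0.preimage_mem_nhds ((isOpen_chronologicalFuture_of_boundaryless g₁ τ₁ S₁).mem_nhds
      (by rw [hΔ0]; exact hpI))
  obtain ⟨ε, hε, hball⟩ := Metric.mem_nhds_iff.1 hnhds
  set t₁ : ℝ := max t₀ (-(ε / 2)) with ht₁
  have ht₁neg : t₁ < 0 := max_lt ht₀ (by linarith)
  have ht₁D : t₁ ∈ D := hΔ.1.out ht₀D h0D ⟨le_max_left _ _, ht₁neg.le⟩
  have ht₁ε : t₁ ∈ Metric.ball (0 : ℝ) ε := by
    rw [Metric.mem_ball, Real.dist_eq, sub_zero, abs_of_neg ht₁neg]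
    have : -(ε / 2) ≤ t₁ := le_max_right _ _
    linarith
  set t₂ : ℝ := t₁ / 2 with ht₂
  have ht₁₂ : t₁ < t₂ := by rw [ht₂]; linarith
  have ht₂neg : t₂ < 0 := by rw [ht₂]; linarith
  have ht₂D : t₂ ∈ D := hΔ.1.out ht₁D h0D ⟨ht₁₂.le, ht₂neg.le⟩
  have hIcc : Icc t₁ 0 ⊆ D := hΔ.1.out ht₁D h0D
  have hΔt : g₁.IsFutureTimelikeCurveOn τ₁ Δ (Icc t₁ 0) := hΔ.2.1.mono hIcc
  have hrI : Δ t₁ ∈ g₁.chronologicalFuture τ₁ S₁ := hball ht₁ε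
  have hr₁r : Δ t₂ ∈ g₁.chronologicalFuture τ₁ {Δ t₁} :=
    mem_chronologicalFuture_of_curve hΔt le_rfl ht₁₂ ht₂neg.le
  have hpr₁ : p ∈ g₁.chronologicalFuture τ₁ {Δ t₂} := by
    rw [← hΔ0]
    exact mem_chronologicalFuture_of_curve hΔt ht₁₂.le ht₂neg le_rfl
  have hpr : p ∈ g₁.chronologicalFuture τ₁ {Δ t₁} := mem_chronologicalFuture_trans hr₁r hpr₁
  have hr₁I : Δ t₂ ∈ g₁.chronologicalFuture τ₁ S₁ := mem_chronologicalFuture_trans hrI hr₁r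
  refine ⟨Δ t₁, Δ t₂, ?_, ?_, hrI, hr₁r, hpr₁⟩
  · exact hA.mem_opens_of_mem_closure_of_mem_chronologicalFuture hn₁ hres₁ hτ₁ hU
      (chronologicalFuture_subset_causalFuture g₁ τ₁ S₁ hrI) (frontier_subset_closure hp) hpr
  · exact hA.mem_opens_of_mem_closure_of_mem_chronologicalFuture hn₁ hres₁ hτ₁ hU
      (chronologicalFuture_subset_causalFuture g₁ τ₁ S₁ hr₁I) (frontier_subset_closure hp) hpr₁

omit [T2Space M₂] [SecondCountableTopology M₂] [BoundarylessManifold I₂ M₂] [FiniteDimensional ℝ E₂] in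
/-- **`ψ` preserves `≪` between points of `U`.** If `x, y ∈ U` and `x ≪ y` in `M₁`, the timelike
segment from `x` to `y` lies in `U` (causal convexity of `U`,
`IsCauchyHypersurface.mem_opens_of_isFutureCausalCurveOn`), so it is carried by `ψ` to a timelike
segment of `M₂` (`hpush`): `ψ x ≪ ψ y`. Sbierski 2016, §3.2, proof of Prop. 13.
[cite: Sbierski2016AHP, §3.2, proof of Prop. 13 (arXiv numbering)] -/
theorem glue_mem_chronologicalFuture_of_mem (hn₁ : 2 ≤ n₁)
    (hres₁ : PseudoRiemannianMetric.contMDiff_restrict (I := I₁) (n := n₁) (M := M₁))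
    (hτ₁ : τ₁.contMDiff_restrict) {S₁ : Set M₁} (hS₁ : g₁.IsCauchyHypersurface τ₁ S₁)
    {U : Opens M₁}
    (hU : (g₁.restrict hres₁ U).IsCauchyHypersurface (τ₁.restrict hres₁ hτ₁ U) (Subtype.val ⁻¹' S₁))
    {ψ : M₁ → M₂}
    (hpush : ∀ ⦃γ : ℝ → M₁⦄ ⦃a b : ℝ⦄, a < b → g₁.IsFutureTimelikeCurveOn τ₁ γ (Icc a b) →
      (∀ t ∈ Icc a b, γ t ∈ U) → ψ (γ b) ∈ g₂.chronologicalFuture τ₂ {ψ (γ a)})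
    {x y : M₁} (hx : x ∈ U) (hy : y ∈ U) (hxy : y ∈ g₁.chronologicalFuture τ₁ {x}) :
    ψ y ∈ g₂.chronologicalFuture τ₂ {ψ x} := by
  obtain ⟨x', hx', γ, a, b, hab, hγ, hγa, hγb⟩ := hxy
  rw [mem_singleton_iff] at hx'
  subst hx'
  have hγU : ∀ t ∈ Icc a b, γ t ∈ U := fun t ht ↦
    hS₁.mem_opens_of_isFutureCausalCurveOn hn₁ hres₁ hτ₁ hU hγ.isFutureCausalCurveOn
      (by rw [hγa]; exact hx) (by rw [hγb]; exact hy) ht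
  have h := hpush hab hγ hγU
  rwa [hγa, hγb] at h

omit [BoundarylessManifold I₂ M₂] in
/-- **`ψ r₁ ≤ p'` for `r₁ ∈ U` with `r₁ ≪ p`, `(p, p')` corresponding**: the points `y ∈ U ∩ I⁺(r₁)`
near `p` are mapped into `I⁺(ψ r₁)` and accumulate at `p'`, so `p' ∈ closure (I⁺(ψ r₁))`, and
`≤` is closed (`hrel₂`). This is *"we get `ψ(q) ≤ p'` since the relation `≤` is closed on
globally hyperbolic manifolds"* in the proof of Prop. 13 of Sbierski 2016, §3.2.
[cite: Sbierski2016AHP, §3.2, proof of Prop. 13 (arXiv numbering)] -/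
theorem mem_causalFuture_glue_of_corresponding (hn₁ : 2 ≤ n₁)
    (hres₁ : PseudoRiemannianMetric.contMDiff_restrict (I := I₁) (n := n₁) (M := M₁))
    (hτ₁ : τ₁.contMDiff_restrict) {S₁ : Set M₁} (hS₁ : g₁.IsCauchyHypersurface τ₁ S₁)
    {U : Opens M₁}
    (hU : (g₁.restrict hres₁ U).IsCauchyHypersurface (τ₁.restrict hres₁ hτ₁ U) (Subtype.val ⁻¹' S₁))
    {ψ : M₁ → M₂}
    (hpush : ∀ ⦃γ : ℝ → M₁⦄ ⦃a b : ℝ⦄, a < b → g₁.IsFutureTimelikeCurveOn τ₁ γ (Icc a b) →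
      (∀ t ∈ Icc a b, γ t ∈ U) → ψ (γ b) ∈ g₂.chronologicalFuture τ₂ {ψ (γ a)})
    (hrel₂ : ∀ {xs ys : ℕ → M₂} {x y : M₂}, Tendsto xs atTop (𝓝 x) → Tendsto ys atTop (𝓝 y) →
      (∀ j, ys j ∈ g₂.causalFuture τ₂ {xs j}) → y ∈ g₂.causalFuture τ₂ {x})
    {p : M₁} {p' : M₂}
    (hcorr : ∀ V ∈ 𝓝 p, ∀ V' ∈ 𝓝 p', ∃ y ∈ (U : Set M₁), y ∈ V ∧ ψ y ∈ V')
    {r₁ : M₁} (hr₁ : r₁ ∈ U) (hpr₁ : p ∈ g₁.chronologicalFuture τ₁ {r₁}) :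
    p' ∈ g₂.causalFuture τ₂ {ψ r₁} := by
  haveI : LocallyCompactSpace M₂ := Manifold.locallyCompact_of_finiteDimensional (M := M₂) I₂
  haveI : TopologicalSpace.MetrizableSpace M₂ := Manifold.metrizableSpace I₂ M₂
  letI : MetricSpace M₂ := TopologicalSpace.metrizableSpaceMetric M₂
  have hcl : p' ∈ closure (g₂.chronologicalFuture τ₂ {ψ r₁}) := by
    rw [mem_closure_iff_nhds]
    intro V' hV'
    obtain ⟨y, hyU, hyV, hyV'⟩ := hcorr _
      ((isOpen_chronologicalFuture_of_boundaryless g₁ τ₁ {r₁}).mem_nhds hpr₁) V' hV'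
    exact ⟨ψ y, hyV', glue_mem_chronologicalFuture_of_mem hn₁ hres₁ hτ₁ hS₁ hU hpush hr₁ hyU hyV⟩
  exact mem_causalFuture_of_mem_closure_chronologicalFuture hrel₂ hcl

/-- **`ψ r ≪ p'`, `p' ∈ I⁺(S₂)` and `p' ∉ S₂`** for `r ≪ r₁ ≪ p` in `U` with `r ∈ I⁺(S₁)`:
`ψ r ≪ ψ r₁ ≤ p'` and push-up (O'Neill's Cor. 14.1); a point `s ∈ S₁` below `r` is mapped to
`ψ s ∈ S₀ ⊆ S₂` below `ψ r`; and `S₂` is achronal. Sbierski 2016, §3.2, proof of Prop. 13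
("this then gives `ψ(q) ≪ ψ(s) ≤ p'`, and thus `ψ(q) ≪ p'`"). [cite: Sbierski2016AHP, §3.2, proof of Prop. 13 (arXiv numbering)] -/
theorem mem_chronologicalFuture_glue_of_corresponding (hn₁ : 2 ≤ n₁) (hn₂ : 2 ≤ n₂)
    (hres₁ : PseudoRiemannianMetric.contMDiff_restrict (I := I₁) (n := n₁) (M := M₁))
    (hτ₁ : τ₁.contMDiff_restrict) {S₁ : Set M₁} (hS₁ : g₁.IsCauchyHypersurface τ₁ S₁)
    {U : Opens M₁} (hS₁U : S₁ ⊆ U)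
    (hU : (g₁.restrict hres₁ U).IsCauchyHypersurface (τ₁.restrict hres₁ hτ₁ U) (Subtype.val ⁻¹' S₁))
    {S₂ S₀ : Set M₂} (hS₂ : g₂.IsCauchyHypersurface τ₂ S₂) (hS₀S : S₀ ⊆ S₂)
    {ψ : M₁ → M₂} (hψS : ψ '' S₁ = S₀)
    (hpush : ∀ ⦃γ : ℝ → M₁⦄ ⦃a b : ℝ⦄, a < b → g₁.IsFutureTimelikeCurveOn τ₁ γ (Icc a b) →
      (∀ t ∈ Icc a b, γ t ∈ U) → ψ (γ b) ∈ g₂.chronologicalFuture τ₂ {ψ (γ a)})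
    (hrel₂ : ∀ {xs ys : ℕ → M₂} {x y : M₂}, Tendsto xs atTop (𝓝 x) → Tendsto ys atTop (𝓝 y) →
      (∀ j, ys j ∈ g₂.causalFuture τ₂ {xs j}) → y ∈ g₂.causalFuture τ₂ {x})
    {p : M₁} {p' : M₂}
    (hcorr : ∀ V ∈ 𝓝 p, ∀ V' ∈ 𝓝 p', ∃ y ∈ (U : Set M₁), y ∈ V ∧ ψ y ∈ V')
    {r r₁ : M₁} (hr : r ∈ U) (hr₁ : r₁ ∈ U) (hrI : r ∈ g₁.chronologicalFuture τ₁ S₁)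
    (hrr₁ : r₁ ∈ g₁.chronologicalFuture τ₁ {r}) (hpr₁ : p ∈ g₁.chronologicalFuture τ₁ {r₁}) :
    p' ∈ g₂.chronologicalFuture τ₂ {ψ r} ∧ ψ r ∈ g₂.chronologicalFuture τ₂ S₂ ∧
      p' ∈ g₂.chronologicalFuture τ₂ S₂ ∧ p' ∉ S₂ := by
  have hn2' : (1 : ℕ∞ω) ≤ n₂ := le_trans one_le_two hn₂
  have hle : p' ∈ g₂.causalFuture τ₂ {ψ r₁} :=
    mem_causalFuture_glue_of_corresponding hn₁ hres₁ hτ₁ hS₁ hU hpush hrel₂ hcorr hr₁ hpr₁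
  have hll : ψ r₁ ∈ g₂.chronologicalFuture τ₂ {ψ r} :=
    glue_mem_chronologicalFuture_of_mem hn₁ hres₁ hτ₁ hS₁ hU hpush hr hr₁ hrr₁
  have h1 : p' ∈ g₂.chronologicalFuture τ₂ {ψ r} :=
    mem_chronologicalFuture_of_mem_chronologicalFuture_of_mem_causalFuture hn2' hll hle
  -- `ψ r ∈ I⁺(S₂)`: a point `s ∈ S₁` below `r` is mapped to `ψ s ∈ S₀ ⊆ S₂` below `ψ r`
  have h2 : ψ r ∈ g₂.chronologicalFuture τ₂ S₂ := by
    have h := hrI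
    rw [chronologicalFuture_eq_biUnion] at h
    simp only [mem_iUnion, exists_prop] at h
    obtain ⟨s, hsS, hrs⟩ := h
    have hψs : ψ s ∈ S₂ := hS₀S (by rw [← hψS]; exact mem_image_of_mem ψ hsS)
    have h3 : ψ r ∈ g₂.chronologicalFuture τ₂ {ψ s} :=
      glue_mem_chronologicalFuture_of_mem hn₁ hres₁ hτ₁ hS₁ hU hpush (hS₁U hsS) hr hrs
    exact chronologicalFuture_mono (singleton_subset_iff.2 hψs) h3
  have h3 : p' ∈ g₂.chronologicalFuture τ₂ S₂ := mem_chronologicalFuture_trans h2 h1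
  refine ⟨h1, h2, h3, fun hp'S ↦ ?_⟩
  have hA : g₂.IsAchronal τ₂ S₂ := IsCauchyHypersurface.isAchronal_holds hn₂ hS₂
  exact (Set.disjoint_left.1 ((isAchronal_iff_disjoint S₂).1 hA)) h3 hp'S

/-- **The image point of a future corresponding pair is not in `closure (I⁻(S₂))`**: a point
`q' ∈ I⁻(S₂)` in the open neighbourhood `I⁺(ψ r)` of `p'` would give `ψ r ≪ q' ≪ k ∈ S₂` with
`ψ r ∈ I⁺(S₂)` — two chronologically related points of the achronal `S₂`. In particular
`p' ∉ closure (I⁻(S₂ ∖ S₀))`. [cite: Sbierski2016AHP, §3.2, proof of Prop. 13 (arXiv numbering)] -/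
theorem not_mem_closure_chronologicalPast_of_corresponding (hn₂ : 2 ≤ n₂)
    {S₂ : Set M₂} (hS₂ : g₂.IsCauchyHypersurface τ₂ S₂) {p' z : M₂}
    (hzp' : p' ∈ g₂.chronologicalFuture τ₂ {z}) (hz : z ∈ g₂.chronologicalFuture τ₂ S₂)
    {K : Set M₂} (hK : K ⊆ S₂) : p' ∉ closure (g₂.chronologicalPast τ₂ K) := by
  intro h
  have hA : g₂.IsAchronal τ₂ S₂ := IsCauchyHypersurface.isAchronal_holds hn₂ hS₂
  obtain ⟨q', hq'I, hq'K⟩ := mem_closure_iff.1 h _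
    (isOpen_chronologicalFuture_of_boundaryless g₂ τ₂ {z}) hzp'
  rw [chronologicalPast, chronologicalFuture_eq_biUnion] at hq'K
  simp only [mem_iUnion, exists_prop] at hq'K
  obtain ⟨k, hkK, hq'k⟩ := hq'K
  have hkq' : k ∈ g₂.chronologicalFuture τ₂ {q'} := mem_chronologicalFuture_of_mem_chronologicalPast hq'k
  have hzk : k ∈ g₂.chronologicalFuture τ₂ {z} := mem_chronologicalFuture_trans hq'I hkq'
  have hSk : k ∈ g₂.chronologicalFuture τ₂ S₂ := mem_chronologicalFuture_trans hz hzk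
  exact (Set.disjoint_left.1 ((isAchronal_iff_disjoint S₂).1 hA)) hSk (hK hkK)

omit [T2Space M₁] [SecondCountableTopology M₁] [FiniteDimensional ℝ E₁] in
/-- **The shadow bound** (Prop. 13, second half, read on the data hypersurfaces). Let `(p, p')`
correspond, `p ≪ p⁺`. Then every point `z ∈ I⁻(p') ∩ S₂` is the image `ψ s` of a point
`s ∈ J⁻(p⁺) ∩ S₁`: indeed `z ≪ ψ y` for some `y ∈ U ∩ I⁻(p⁺)` near `p` (the pair corresponds and
`I⁺(z)`, `I⁻(p⁺)` are open), so `z ∈ W` (no timelike entry into `W` from `J⁺(S₂) ∖ W`), hence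
`z ∈ W ∩ S₂ ⊆ S₀ = ψ(S₁)`, `z = ψ s`; the timelike segment from `z` to `ψ y` stays in `W` (causal
convexity) and pulls back to `s ≪ y ≪ p⁺`. Sbierski 2016, §3.2, proof of Prop. 13 ("The other
inclusion follows by symmetry"). [cite: Sbierski2016AHP, §3.2, proof of Prop. 13 (arXiv numbering)] -/
theorem chronologicalPast_inter_subset_image_of_corresponding (hn₂ : 2 ≤ n₂)
    (hres₂ : PseudoRiemannianMetric.contMDiff_restrict (I := I₂) (n := n₂) (M := M₂))
    (hτ₂ : τ₂.contMDiff_restrict) {S₁ : Set M₁} {U : Opens M₁} (hS₁U : S₁ ⊆ U)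
    {S₂ S₀ : Set M₂} (hS₂ : g₂.IsCauchyHypersurface τ₂ S₂) {W : Opens M₂}
    (hW : (g₂.restrict hres₂ W).IsCauchyHypersurface (τ₂.restrict hres₂ hτ₂ W) (Subtype.val ⁻¹' S₂))
    (hWS : (W : Set M₂) ∩ S₂ ⊆ S₀) {ψ : M₁ → M₂} (hψW : MapsTo ψ U W) (hψS : ψ '' S₁ = S₀)
    (hpull : ∀ ⦃γ : ℝ → M₂⦄ ⦃a b : ℝ⦄, a < b → g₂.IsFutureTimelikeCurveOn τ₂ γ (Icc a b) →
      (∀ t ∈ Icc a b, γ t ∈ W) → ∀ ⦃x y : M₁⦄, x ∈ U → y ∈ U → γ a = ψ x → γ b = ψ y →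
      y ∈ g₁.chronologicalFuture τ₁ {x})
    {p pf : M₁} (hpp : pf ∈ g₁.chronologicalFuture τ₁ {p}) {p' : M₂}
    (hcorr : ∀ V ∈ 𝓝 p, ∀ V' ∈ 𝓝 p', ∃ y ∈ (U : Set M₁), y ∈ V ∧ ψ y ∈ V') :
    g₂.chronologicalPast τ₂ {p'} ∩ S₂ ⊆ ψ '' (g₁.causalPast τ₁ {pf} ∩ S₁) := by
  rintro z ⟨hzp', hzS⟩
  have hA : g₂.IsAchronal τ₂ S₂ := IsCauchyHypersurface.isAchronal_holds hn₂ hS₂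
  have hp'z : p' ∈ g₂.chronologicalFuture τ₂ {z} := mem_chronologicalFuture_of_mem_chronologicalPast hzp'
  -- a point `y ∈ U`, `y ≪ p⁺`, with `z ≪ ψ y`
  obtain ⟨y, hyU, hyp, hzy⟩ := hcorr _
    ((isOpen_chronologicalPast_of_boundaryless g₁ τ₁ {pf}).mem_nhds
      (mem_chronologicalPast_of_mem_chronologicalFuture hpp)) _
    ((isOpen_chronologicalFuture_of_boundaryless g₂ τ₂ {z}).mem_nhds hp'z)
  -- `z ∈ W`, hence `z = ψ s` with `s ∈ S₁`
  have hzW : z ∈ W :=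
    hA.mem_opens_of_mem_chronologicalFuture hn₂ hres₂ hτ₂ hW (subset_causalFuture g₂ τ₂ S₂ hzS)
      (hψW hyU) hzy
  have hzS₀ : z ∈ S₀ := hWS ⟨hzW, hzS⟩
  rw [← hψS] at hzS₀
  obtain ⟨s, hsS, rfl⟩ := hzS₀
  refine ⟨s, ⟨?_, hsS⟩, rfl⟩
  -- the segment from `ψ s` to `ψ y` stays in `W` and pulls back: `s ≪ y ≪ p⁺`
  obtain ⟨z', hz', γ, a, b, hab, hγ, hγa, hγb⟩ := hzy
  rw [mem_singleton_iff] at hz'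
  subst hz'
  have hγW : ∀ t ∈ Icc a b, γ t ∈ W := fun t ht ↦
    hS₂.mem_opens_of_isFutureCausalCurveOn hn₂ hres₂ hτ₂ hW hγ.isFutureCausalCurveOn
      (by rw [hγa]; exact hzW) (by rw [hγb]; exact hψW hyU) ht
  have hsy : y ∈ g₁.chronologicalFuture τ₁ {s} := hpull hab hγ hγW (hS₁U hsS) hyU hγa hγb
  have hsp : pf ∈ g₁.chronologicalFuture τ₁ {s} :=
    mem_chronologicalFuture_trans hsy (mem_chronologicalFuture_of_mem_chronologicalPast hyp)
  exact chronologicalFuture_subset_causalFuture g₁ τ₁.reverse {pf}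
    (mem_chronologicalPast_of_mem_chronologicalFuture hsp)

omit [T2Space M₂] [SecondCountableTopology M₂] in
/-- **`ψ(J⁻(p⁺) ∩ S₁)` is a compact subset of `S₀`**: `J⁻(p⁺) ∩ S₁ = (J⁻(p⁺) ∩ J⁺(S₁)) ∩ S₁`
is compact (`hK₁`, Hawking–Ellis 1973, Prop. 6.6.6, and `S₁` is closed, O'Neill's Lemma 14.29),
contained in `S₁ ⊆ U` on which `ψ` is continuous. [cite: HawkingEllis1973CUP, §6.6, Prop. 6.6.6] -/
theorem isCompact_image_causalPast_inter (hn₁ : 2 ≤ n₁) {S₁ : Set M₁}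
    (hS₁ : g₁.IsCauchyHypersurface τ₁ S₁) {U : Opens M₁} (hS₁U : S₁ ⊆ U)
    (hK₁ : ∀ x : M₁, IsCompact (g₁.causalPast τ₁ {x} ∩ g₁.causalFuture τ₁ S₁))
    {ψ : M₁ → M₂} (hψc : ContinuousOn ψ U) (pf : M₁) :
    IsCompact (ψ '' (g₁.causalPast τ₁ {pf} ∩ S₁)) := by
  have hcl : IsClosed S₁ := IsCauchyHypersurface.isClosed_holds hn₁ hS₁
  have heq : g₁.causalPast τ₁ {pf} ∩ S₁ = (g₁.causalPast τ₁ {pf} ∩ g₁.causalFuture τ₁ S₁) ∩ S₁ := by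
    ext x
    exact ⟨fun h ↦ ⟨⟨h.1, subset_causalFuture g₁ τ₁ S₁ h.2⟩, h.2⟩, fun h ↦ ⟨h.1.1, h.2⟩⟩
  rw [heq]
  exact ((hK₁ pf).inter_right hcl).image_of_continuousOn (hψc.mono fun x hx ↦ hS₁U hx.2)

end Core

end LorentzianMetric

end Literature.Geometry.Lorentzian

end
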